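import Summits.AnomalousDissipation.AnomalousDissipation.Theorems.MarginalStabilityChainStrainedLayerLawClockCirculationDensityLawTools
import HarnessLib

/-!
# Crux `MarginalStabilityChain.StrainedLayerLaw` (stmt-AnomalousDissipation-3007), line `FirstLemmasR2K4`
# (log-enstrophy clock + Nash roundness): the circulation-density law (weak form)

Support file (`--supports stmt-AnomalousDissipation-3007`; registered sub-goal `circulationDensity_weak_law` of line
`FirstLemmasR2K4`, lead c7, wave 2).

What it proves: along every classical solution `(u, v, p)` of the stretched two-dimensional Navier–Stokes layer class
on `(0, ∞)` (`ν, L > 0`, normalisation `γ = ΔU = 1`) with shear tails on every compact time interval, the circulation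
density `γ(x, t) = −∫_y ω` (`ω = ∂ₓv − ∂_yu`) and the column Reynolds stress `Π(x, t) = ∫_y uv` obey the EXACT
one-dimensional conservation law `∂ₜγ = ∂ₓₓ(Π + νγ)` in weak form: for every `L`-periodic `φ ∈ C²` and `0 < s ≤ t`,
`∫∫ φω(t) − ∫∫ φω(s) = ∫_s^t (ν∫∫ φ″ω − ∫∫ φ″uv) dτ` (iterated integrals over one period strip). The large-scale
distribution of circulation along the layer changes only through Reynolds stresses and viscosity.

Route (rigorous, cutoff in `y`; slice tools in `…ClockCirculationDensityLawTools.lean`): with the cutoff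
`ψ_R(y) = σ(2 − y/R)σ(2 + y/R)` (`σ` = `Real.smoothTransition`) and `Φ_R = φ(x)ψ_R(y)`, differentiation under the
integral sign gives `N_R′(τ) = ∫∫ Φ_R ∂ₜω` on `τ > 0` (`N_R = ∫∫ Φ_R ω`, `circLaw_hasDerivAt`), and the weak vorticity
balance `stub_vorticityUniformBounds_weakVorticity` tested against `Φ_R` identifies it with
`∫∫ ω(u∂ₓΦ_R + (v − y)∂_yΦ_R) − ν∫∫ ∇ω·∇Φ_R` (`circLaw_slice_identity`); the fundamental theorem of calculus on `[s, t]`;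
`R → ∞` by dominated convergence on the strip at each instant (tools) and in time (majorants uniform on `[s, t]`):
`N(t) − N(s) = ∫_s^t (∫∫ ωuφ′ − ν∫∫ ∂ₓω φ′)` (`circLaw_strip_identity`); finally `∫∫ ωuφ′ = −∫∫ φ″uv` and
`∫∫ ∂ₓω φ′ = −∫∫ φ″ω` (tools) and Fubini. All `[folklore]` (e.g. Majda–Bertozzi, *Vorticity and Incompressible
Flow*, CUP 2002, §1.4, for the stretched 2-D class and its moment laws).
-/

-- `Summit.<Summit>.<Problem>` is the tree's mandated summit-side namespace (CONVENTIONS §2); for this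
-- single-conjunct summit the two coincide, so the duplicate is deliberate.
set_option linter.dupNamespace false

noncomputable section

open scoped Topology ENNReal
open Filter Set Function MeasureTheory

namespace Summit.AnomalousDissipation.AnomalousDissipation.Theorems.StrainedLayerLaw.LogEnstrophyClock

open Literature.Analysis.FluidPDE Literature.Analysis.FluidPDE.StretchedLayer
open Summit.AnomalousDissipation.AnomalousDissipation.Theses.MarginalStabilityChain
open Summit.AnomalousDissipation.AnomalousDissipation.Theorems.StrainedLayerLaw.StrainWorkSumRule

/-! ## Periodic `C²` test functions -/

section TestFunction

/-- An `L`-periodic `C²` test function (`L > 0`): `φ′ = deriv φ` and `φ″ = deriv (deriv φ)` exist everywhere, are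
continuous and `L`-periodic, and `φ, φ′, φ″` are bounded by one constant. [folklore] -/
theorem circLaw_testFunction {φ : ℝ → ℝ} {L : ℝ} (hL : 0 < L) (hφ : ContDiff ℝ 2 φ)
    (hper : ∀ x, φ (x + L) = φ x) :
    (∀ x, HasDerivAt φ (deriv φ x) x) ∧ (∀ x, HasDerivAt (deriv φ) (deriv (deriv φ) x) x) ∧
    Continuous (deriv φ) ∧ Continuous (deriv (deriv φ)) ∧
    (∀ x, deriv φ (x + L) = deriv φ x) ∧ (∀ x, deriv (deriv φ) (x + L) = deriv (deriv φ) x) ∧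
    ∃ A, 0 < A ∧ (∀ x, |φ x| ≤ A) ∧ (∀ x, |deriv φ x| ≤ A) ∧ (∀ x, |deriv (deriv φ) x| ≤ A) := by
  have h2 : ContDiff ℝ (1 + 1) φ := by rw [one_add_one_eq_two]; exact hφ
  obtain ⟨hd1, -, hφ1⟩ := contDiff_succ_iff_deriv.1 h2
  have h1 : ContDiff ℝ (0 + 1) (deriv φ) := by rw [zero_add]; exact hφ1
  obtain ⟨hd2, -, hφ0⟩ := contDiff_succ_iff_deriv.1 h1
  have c1 : Continuous (deriv φ) := hφ1.continuous
  have c2 : Continuous (deriv (deriv φ)) := hφ0.continuous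
  have p1 : ∀ x, deriv φ (x + L) = deriv φ x := fun x => by
    have e : (fun s => φ (s + L)) = φ := funext hper
    rw [← deriv_comp_add_const φ L x, e]
  have p2 : ∀ x, deriv (deriv φ) (x + L) = deriv (deriv φ) x := fun x => by
    have e : (fun s => deriv φ (s + L)) = deriv φ := funext p1
    rw [← deriv_comp_add_const (deriv φ) L x, e]
  obtain ⟨M0, hM0⟩ := exists_abs_le_of_periodic hL hφ.continuous hper
  obtain ⟨M1, hM1⟩ := exists_abs_le_of_periodic hL c1 p1
  obtain ⟨M2, hM2⟩ := exists_abs_le_of_periodic hL c2 p2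
  refine ⟨fun x => (hd1 x).hasDerivAt, fun x => (hd2 x).hasDerivAt, c1, c2, p1, p2,
    max (max M0 M1) (max M2 1), lt_max_of_lt_right (lt_max_of_lt_right one_pos),
    fun x => (hM0 x).trans ((le_max_left _ _).trans (le_max_left _ _)),
    fun x => (hM1 x).trans ((le_max_right _ _).trans (le_max_left _ _)),
    fun x => (hM2 x).trans ((le_max_left _ _).trans (le_max_right _ _))⟩

end TestFunction

/-! ## Differentiation in time under the integral sign for a test function `Φ(x, y)` -/

section TimeDerivative

variable {u v : ℝ → ℝ → ℝ → ℝ}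

/-- **`d/dτ ∫∫ Φ ω(τ) = ∫∫ Φ (∂ₓ∂ₜv − ∂_y∂ₜu)`** on `τ > 0` for `u, v` jointly `C²` on `(0,∞) × ℝ²` and a continuous
bounded test function `Φ(x, y)` vanishing for `|y| ≥ R′` (dominated differentiation: `∂ₜω` is continuous on
`(0,∞) × ℝ²`, hence bounded on `[τ/2, τ + 1] × [0, L] × [−R′, R′]`). [folklore] -/
theorem circLaw_hasDerivAt (hu : ContDiffOn ℝ 2 (fun q : ℝ × ℝ × ℝ => u q.1 q.2.1 q.2.2) (Ioi 0 ×ˢ univ))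
    (hv : ContDiffOn ℝ 2 (fun q : ℝ × ℝ × ℝ => v q.1 q.2.1 q.2.2) (Ioi 0 ×ˢ univ)) {Φ : ℝ → ℝ → ℝ}
    (cΦ : Continuous fun q : ℝ × ℝ => Φ q.1 q.2) {A R' : ℝ} (hΦA : ∀ x y, |Φ x y| ≤ A)
    (hΦ0 : ∀ x y, R' ≤ |y| → Φ x y = 0) (L : ℝ) {τ : ℝ} (hτ : 0 < τ) :
    HasDerivAt (fun s => ∫ q in Ioc 0 L ×ˢ univ, Φ q.1 q.2 * vorticity (u s) (v s) q.1 q.2)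
      (∫ q in Ioc 0 L ×ˢ univ, Φ q.1 q.2 *
        (dX (fun x y => deriv (fun s => v s x y) τ) q.1 q.2 - dY (fun x y => deriv (fun s => u s x y) τ) q.1 q.2)) τ := by
  have hA : 0 ≤ A := (abs_nonneg _).trans (hΦA 0 0)
  have hlo : 0 < τ / 2 := half_pos hτ
  have hI : τ ∈ Ioo (τ / 2) (τ + 1) := ⟨by linarith, by linarith⟩
  have hpos : ∀ {s : ℝ}, s ∈ Ioo (τ / 2) (τ + 1) → 0 < s := fun hs => hlo.trans hs.1
  have hSm : MeasurableSet (Ioc (0:ℝ) L ×ˢ (univ : Set ℝ)) := measurableSet_Ioc.prod MeasurableSet.univ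
  set Ψ : ℝ × ℝ × ℝ → ℝ := fun q => dX (fun x y => deriv (fun s => v s x y) q.1) q.2.1 q.2.2 -
    dY (fun x y => deriv (fun s => u s x y) q.1) q.2.1 q.2.2 with hΨ
  have hΨc : ContinuousOn Ψ (Ioi 0 ×ˢ univ) := kato_continuousOn_vorticity_time hu hv
  have hK : IsCompact (Icc (τ / 2) (τ + 1) ×ˢ (Icc (0:ℝ) L ×ˢ Icc (-R') R')) :=
    isCompact_Icc.prod (isCompact_Icc.prod isCompact_Icc)
  have hKO : Icc (τ / 2) (τ + 1) ×ˢ (Icc (0:ℝ) L ×ˢ Icc (-R') R') ⊆ Ioi (0:ℝ) ×ˢ (univ : Set (ℝ × ℝ)) :=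
    fun q hq => ⟨hlo.trans_le hq.1.1, mem_univ _⟩
  obtain ⟨M, hM⟩ := hK.exists_bound_of_continuousOn (hΨc.mono hKO)
  have hM0 : 0 ≤ max M 0 := le_max_right _ _
  have cω : ∀ {s : ℝ}, 0 < s → Continuous fun q : ℝ × ℝ => vorticity (u s) (v s) q.1 q.2 := fun hs =>
    (contDiff_one_vorticity (contDiff_slice hu (mem_Ioi.2 hs)) (contDiff_slice hv (mem_Ioi.2 hs))).continuous
  have cΨt : Continuous fun q : ℝ × ℝ => Ψ (τ, q) :=
    hΨc.comp_continuous (continuous_const.prodMk continuous_id) fun q => ⟨hτ, mem_univ _⟩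
  have hw1 : ∀ y : ℝ, |y| < R' → 1 ≤ Real.exp R' * Real.exp (-1 * |y|) := fun y hy => by
    rw [← Real.exp_add]; exact Real.one_le_exp (by linarith)
  have key := hasDerivAt_integral_of_dominated_loc_of_deriv_le (μ := volume.restrict (Ioc 0 L ×ˢ univ))
    (F := fun s q => Φ q.1 q.2 * vorticity (u s) (v s) q.1 q.2) (F' := fun s q => Φ q.1 q.2 * Ψ (s, q))
    (bound := fun q => A * max M 0 * Real.exp R' * Real.exp (-1 * |q.2|)) (Ioo_mem_nhds hI.1 hI.2)
    ?_ ?_ ?_ ?_ ?_ ?_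
  · exact key.2
  · filter_upwards [Ioo_mem_nhds hI.1 hI.2] with s hs
    exact (cΦ.mul (cω (hpos hs))).aestronglyMeasurable
  · exact kato_integrableOn_strip_of_eq_zero (R := R') (cΦ.mul (cω hτ)) fun x _ y hy => by
      simp only [hΦ0 x y hy, zero_mul]
  · exact (cΦ.mul cΨt).aestronglyMeasurable
  · refine ae_restrict_of_forall_mem hSm ?_
    rintro ⟨x, y⟩ ⟨hx, -⟩ s hs
    rw [Real.norm_eq_abs]
    by_cases hy : R' ≤ |y|
    · simp only [hΦ0 x y hy, zero_mul, abs_zero]; positivity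
    · push Not at hy
      have hq : ((s, x, y) : ℝ × ℝ × ℝ) ∈ Icc (τ / 2) (τ + 1) ×ˢ (Icc (0:ℝ) L ×ˢ Icc (-R') R') :=
        ⟨⟨hs.1.le, hs.2.le⟩, ⟨hx.1.le, hx.2⟩, abs_le.1 hy.le⟩
      have h1 : |Ψ (s, x, y)| ≤ max M 0 := (Real.norm_eq_abs _ ▸ hM _ hq).trans (le_max_left _ _)
      rw [abs_mul]
      calc |Φ x y| * |Ψ (s, x, y)| ≤ A * max M 0 := mul_le_mul (hΦA x y) h1 (abs_nonneg _) hA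
        _ = A * max M 0 * 1 := by ring
        _ ≤ A * max M 0 * (Real.exp R' * Real.exp (-1 * |y|)) := mul_le_mul_of_nonneg_left (hw1 y hy) (by positivity)
        _ = A * max M 0 * Real.exp R' * Real.exp (-1 * |y|) := by ring
  · show IntegrableOn (fun q : ℝ × ℝ => A * max M 0 * Real.exp R' * Real.exp (-1 * |q.2|)) (Ioc 0 L ×ˢ univ)
    refine integrableOn_strip_of_abs_le_exp (C := A * max M 0 * Real.exp R') (k := 1) (by fun_prop) (by positivity)
      one_pos fun x _ y => ?_
    rw [abs_of_nonneg (by positivity)]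
  · refine ae_restrict_of_forall_mem hSm ?_
    rintro ⟨x, y⟩ - s hs
    have h := (stub_vorticityUniformBounds_vorticityTime hu hv (hpos hs) x y).const_mul (Φ x y)
    refine h.congr_deriv ?_
    simp only [hΨ]

end TimeDerivative

/-! ## Along the solution: the weak balance against `φ(x)θ(y)`, and the strip identity -/

section Solution

variable {ν L : ℝ} {u v p : ℝ → ℝ → ℝ → ℝ}

/-- **The weak vorticity balance along a classical solution, tested against `Φ(x, y) = φ(x)θ(y)`** at time `t > 0`
(`φ ∈ C¹` `L`-periodic, `θ ∈ C¹` vanishing for `|y| ≥ R′`; `∂ₓΦ = φ′θ`, `∂_yΦ = φθ′`):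
`∫∫ φθ (∂ₓ∂ₜv − ∂_y∂ₜu) = ∫∫ ω(u φ′θ + (v − y) φθ′) − ν∫∫ (∂ₓω φ′θ + ∂_yω φθ′)` (`stub_vorticityUniformBounds_weakVorticity`
applied to the slices at time `t`; the time-derivative slices are `C¹`, `x`-periodic and satisfy the momentum equations).
[folklore] -/
theorem circLaw_slice_identity (hsol : IsStretchedLayerNSSolutionOn (Ioi 0) ν 1 1 L u v p) (hL : 0 < L) {t : ℝ}
    (ht : 0 < t) {φ : ℝ → ℝ} (hφ1 : ContDiff ℝ 1 φ) (hφd : ∀ x, HasDerivAt φ (deriv φ x) x)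
    (hφper : ∀ x, φ (x + L) = φ x) {θ : ℝ → ℝ} (hθ : ContDiff ℝ 1 θ) {R' : ℝ} (hθ0 : ∀ y, R' ≤ |y| → θ y = 0) :
    ∫ q in Ioc 0 L ×ˢ univ, φ q.1 * θ q.2 *
        (dX (fun x y => deriv (fun s => v s x y) t) q.1 q.2 - dY (fun x y => deriv (fun s => u s x y) t) q.1 q.2) =
      (∫ q in Ioc 0 L ×ˢ univ, vorticity (u t) (v t) q.1 q.2 *
          (u t q.1 q.2 * (deriv φ q.1 * θ q.2) + (v t q.1 q.2 - q.2) * (φ q.1 * deriv θ q.2))) -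
        ν * ∫ q in Ioc 0 L ×ˢ univ, (dX (vorticity (u t) (v t)) q.1 q.2 * (deriv φ q.1 * θ q.2) +
          dY (vorticity (u t) (v t)) q.1 q.2 * (φ q.1 * deriv θ q.2)) := by
  have ht' : t ∈ Ioi (0:ℝ) := ht
  have hΦ1 : ContDiff ℝ 1 (fun q : ℝ × ℝ => φ q.1 * θ q.2) := (hφ1.comp contDiff_fst).mul (hθ.comp contDiff_snd)
  have hθd : ∀ y, HasDerivAt θ (deriv θ y) y := fun y => (hθ.differentiable one_ne_zero y).hasDerivAt
  have hX : ∀ x y, dX (fun x y => φ x * θ y) x y = deriv φ x * θ y := fun x y => ((hφd x).mul_const (θ y)).deriv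
  have hY : ∀ x y, dY (fun x y => φ x * θ y) x y = φ x * deriv θ y := fun x y => ((hθd y).const_mul (φ x)).deriv
  have key := stub_vorticityUniformBounds_weakVorticity L ν R' (u t) (v t) (p t)
    (fun x y => deriv (fun s => u s x y) t) (fun x y => deriv (fun s => v s x y) t) (fun x y => φ x * θ y) hL
    (hsol.contDiff_u ht') (hsol.contDiff_v ht') (hsol.contDiff_p ht')
    (kato_contDiff_deriv_time_slice hsol.contDiffOn_u ht) (kato_contDiff_deriv_time_slice hsol.contDiffOn_v ht)
    hΦ1 (fun x y => ?_) (fun x y => ?_) (hsol.divFree t ht') (hsol.periodic_u t ht') (hsol.periodic_v t ht')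
    (hsol.periodic_p t ht') (fun x y => ?_) (fun x y => by simp only [hφper]) (fun x y hy => by
      simp only [hθ0 y hy, mul_zero])
  · simpa only [hX, hY] using key
  · have h := hsol.momentum_x t ht' x y
    rw [dT_of_isOpen isOpen_Ioi u ht', one_mul] at h
    exact h
  · have h := hsol.momentum_y t ht' x y
    rw [dT_of_isOpen isOpen_Ioi v ht', one_mul, one_mul] at h
    exact h
  · exact kato_deriv_time_periodic (fun s hs x y => hsol.periodic_v s hs x y) ht x y

/-- **The strip identity `N(t) − N(s) = ∫_s^t (∫∫ ωuφ′ − ν∫∫ ∂ₓω φ′)`** (`N = ∫∫ φω`, `0 < s ≤ t`) along a classical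
solution with shear tails on compact time intervals, for an `L`-periodic `φ ∈ C²`: the fundamental theorem of calculus
for `N_R = ∫∫ φψ_R ω` on `[s, t]` (`N_R′ = ∫∫ φψ_R ∂ₜω = I₁ − νI₂` by `circLaw_hasDerivAt`, `circLaw_slice_identity`),
then `R → ∞` by dominated convergence on the strip at each instant (tools) and in time (majorants uniform on `[s, t]`
for `R ≥ 1`). [folklore] -/
theorem circLaw_strip_identity (hν : 0 ≤ ν) (hL : 0 < L) (hsol : IsStretchedLayerNSSolutionOn (Ioi 0) ν 1 1 L u v p)
    (htails : ∀ a b : ℝ, 0 < a → a < b → ExpTails (Icc a b) u v) {φ : ℝ → ℝ} (hφ : ContDiff ℝ 2 φ)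
    (hφper : ∀ x, φ (x + L) = φ x) {s t : ℝ} (hs : 0 < s) (hst : s ≤ t) :
    (∫ q in Ioc 0 L ×ˢ univ, φ q.1 * vorticity (u t) (v t) q.1 q.2) -
        (∫ q in Ioc 0 L ×ˢ univ, φ q.1 * vorticity (u s) (v s) q.1 q.2) =
      ∫ τ in s..t, ((∫ q in Ioc 0 L ×ˢ univ, vorticity (u τ) (v τ) q.1 q.2 * u τ q.1 q.2 * deriv φ q.1) -
        ν * ∫ q in Ioc 0 L ×ˢ univ, dX (vorticity (u τ) (v τ)) q.1 q.2 * deriv φ q.1) := by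
  obtain ⟨C, k, hk, hCk⟩ := htails (s / 2) (t + 1) (by positivity) (by linarith)
  have hST : ∀ τ ∈ Icc s t, SliceTails C k (u τ) (v τ) := fun τ hτ =>
    (hCk τ ⟨by linarith [hτ.1], by linarith [hτ.2]⟩).1
  have hC : 0 ≤ C := (hST s ⟨le_rfl, hst⟩).nonneg
  obtain ⟨Cσ, hCσ0, hCσ⟩ := kato_smoothTransition_deriv_bound
  obtain ⟨hφd, -, cφ', -, -, -, A, hA, hφA, hφ'A, -⟩ := circLaw_testFunction hL hφ hφper
  have hφ1 : ContDiff ℝ 1 φ := hφ.of_le one_le_two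
  have cφ : Continuous φ := hφ.continuous
  have hpos : ∀ {τ : ℝ}, τ ∈ Icc s t → 0 < τ := fun hτ => hs.trans_le hτ.1
  have hu2 : ∀ {τ : ℝ}, 0 < τ → ContDiff ℝ 2 (fun q : ℝ × ℝ => u τ q.1 q.2) := fun hτ =>
    hsol.contDiff_u (mem_Ioi.2 hτ)
  have hv2 : ∀ {τ : ℝ}, 0 < τ → ContDiff ℝ 2 (fun q : ℝ × ℝ => v τ q.1 q.2) := fun hτ =>
    hsol.contDiff_v (mem_Ioi.2 hτ)
  have hdiv : ∀ {τ : ℝ}, 0 < τ → ∀ x y, dX (u τ) x y + dY (v τ) x y = 0 := fun hτ => hsol.divFree _ (mem_Ioi.2 hτ)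
  have hIsub : uIoc s t ⊆ Ioi 0 := fun τ hτ => by rw [uIoc_of_le hst] at hτ; exact hs.trans hτ.1
  have hsub : uIcc s t ⊆ Ioi 0 := fun τ hτ => by rw [uIcc_of_le hst] at hτ; exact hs.trans_le hτ.1
  -- the cutoff family
  set ψ : ℝ → ℝ → ℝ := fun R y => Real.smoothTransition (2 - y / R) * Real.smoothTransition (2 + y / R) with hψ
  have hψC1 : ∀ R, ContDiff ℝ 1 (ψ R) := fun R => kato_cutoff_contDiff R
  have hψc : ∀ R, Continuous (ψ R) := fun R => (hψC1 R).continuous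
  have hψ'c : ∀ R, Continuous (deriv (ψ R)) := fun R => (hψC1 R).continuous_deriv le_rfl
  have hψ1 : ∀ R y, |ψ R y| ≤ 1 := fun R y => kato_cutoff_abs_le_one R y
  have hψ0 : ∀ R, 0 < R → ∀ y, 2 * R ≤ |y| → ψ R y = 0 := fun R hR y hy => kato_cutoff_eq_zero hR hy
  have hψ'D : ∀ R, 1 ≤ R → ∀ y, |deriv (ψ R) y| ≤ 2 * Cσ := fun R hR y =>
    (kato_cutoff_deriv_bound (one_pos.trans_le hR) hCσ y).trans (div_le_self (by positivity) hR)
  have hψev : ∀ y, ∀ᶠ R in atTop, ψ R y = 1 ∧ deriv (ψ R) y = 0 := fun y => by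
    filter_upwards [eventually_gt_atTop |y|] with R hR
    have hR0 : 0 < R := (abs_nonneg y).trans_lt hR
    exact ⟨kato_cutoff_eq_one hR0 hR.le, kato_cutoff_deriv_eq_zero_of_lt hR0 hR⟩
  have cΦ : ∀ R, Continuous fun q : ℝ × ℝ => φ q.1 * ψ R q.2 := fun R =>
    (cφ.comp continuous_fst).mul ((hψc R).comp continuous_snd)
  have hΦA : ∀ R x y, |φ x * ψ R y| ≤ A := fun R x y => by
    rw [abs_mul]
    calc |φ x| * |ψ R y| ≤ A * 1 := mul_le_mul (hφA x) (hψ1 R y) (abs_nonneg _) hA.le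
      _ = A := mul_one A
  -- the functionals
  set Ik : ℝ := ∫ q in Ioc 0 L ×ˢ univ, Real.exp (-k * |q.2|) with hIk
  set IW : ℝ := ∫ q in Ioc 0 L ×ˢ univ, (C + |q.2|) * Real.exp (-k * |q.2|) with hIW
  set N : ℝ → ℝ → ℝ := fun R τ => ∫ q in Ioc 0 L ×ˢ univ, φ q.1 * ψ R q.2 * vorticity (u τ) (v τ) q.1 q.2 with hN
  set G : ℝ → ℝ → ℝ := fun R τ => ∫ q in Ioc 0 L ×ˢ univ, φ q.1 * ψ R q.2 *
    (dX (fun x y => deriv (fun s => v s x y) τ) q.1 q.2 - dY (fun x y => deriv (fun s => u s x y) τ) q.1 q.2) with hG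
  set I1 : ℝ → ℝ → ℝ := fun R τ => ∫ q in Ioc 0 L ×ˢ univ, vorticity (u τ) (v τ) q.1 q.2 *
    (u τ q.1 q.2 * (deriv φ q.1 * ψ R q.2) + (v τ q.1 q.2 - q.2) * (φ q.1 * deriv (ψ R) q.2)) with hI1
  set I2 : ℝ → ℝ → ℝ := fun R τ => ∫ q in Ioc 0 L ×ˢ univ, (dX (vorticity (u τ) (v τ)) q.1 q.2 * (deriv φ q.1 * ψ R q.2) +
    dY (vorticity (u τ) (v τ)) q.1 q.2 * (φ q.1 * deriv (ψ R) q.2)) with hI2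
  set J1 : ℝ → ℝ := fun τ => ∫ q in Ioc 0 L ×ˢ univ, vorticity (u τ) (v τ) q.1 q.2 * u τ q.1 q.2 * deriv φ q.1 with hJ1
  set J2 : ℝ → ℝ := fun τ => ∫ q in Ioc 0 L ×ˢ univ, dX (vorticity (u τ) (v τ)) q.1 q.2 * deriv φ q.1 with hJ2
  set M : ℝ → ℝ := fun τ => ∫ q in Ioc 0 L ×ˢ univ, φ q.1 * vorticity (u τ) (v τ) q.1 q.2 with hM
  -- (1) the derivative of `N R` and the continuity of `G R` on `(0, ∞)` (`R > 0`)
  have hder : ∀ R, 0 < R → ∀ τ, 0 < τ → HasDerivAt (N R) (G R τ) τ := fun R hR τ hτ =>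
    circLaw_hasDerivAt hsol.contDiffOn_u hsol.contDiffOn_v (cΦ R) (hΦA R) (fun x y hy => by
      show φ x * ψ R y = 0
      rw [hψ0 R hR y hy, mul_zero]) L hτ
  have hGc : ∀ R, 0 < R → ContinuousOn (G R) (Ioi 0) := fun R hR => by
    have hΨ := kato_continuousOn_vorticity_time hsol.contDiffOn_u hsol.contDiffOn_v
    have hΦc : ContinuousOn (fun r : ℝ × ℝ × ℝ => φ r.2.1 * ψ R r.2.2) (Ioi 0 ×ˢ univ) :=
      ((cΦ R).comp continuous_snd).continuousOn
    exact clock_continuousOn_strip_integral (R' := 2 * R) (H := fun r : ℝ × ℝ × ℝ => φ r.2.1 * ψ R r.2.2 *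
      (dX (fun x y => deriv (fun s => v s x y) r.1) r.2.1 r.2.2 - dY (fun x y => deriv (fun s => u s x y) r.1) r.2.1 r.2.2))
      (hΦc.mul hΨ) (fun τ x y _ hy => by simp only [hψ0 R hR y hy, mul_zero, zero_mul]) L
  -- (2) the fundamental theorem of calculus on `[s, t]`
  have hFTC : ∀ R, 0 < R → N R t - N R s = ∫ τ in s..t, G R τ := fun R hR =>
    (intervalIntegral.integral_eq_sub_of_hasDerivAt (fun τ hτ => hder R hR τ (hsub hτ))
      (((hGc R hR).mono hsub).intervalIntegrable)).symm
  -- (3) the weak balance: `G R τ = I1 R τ − ν I2 R τ`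
  have hGI : ∀ R, 0 < R → ∀ τ, 0 < τ → G R τ = I1 R τ - ν * I2 R τ := fun R hR τ hτ =>
    circLaw_slice_identity hsol hL hτ hφ1 hφd hφper (hψC1 R) (hψ0 R hR)
  -- (4) the limits `R → ∞` at each instant of `[s, t]`
  have hNlim : ∀ {τ : ℝ}, τ ∈ Icc s t → Tendsto (fun R => N R τ) atTop (𝓝 (M τ)) := fun hτ =>
    circLaw_limit_N hk (hST _ hτ) (hu2 (hpos hτ)) (hv2 (hpos hτ)) cφ hφA hψc hψ1 hψev
  have hI1lim : ∀ {τ : ℝ}, τ ∈ Icc s t → Tendsto (fun R => I1 R τ) atTop (𝓝 (J1 τ)) := fun hτ =>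
    circLaw_limit_I1 hk (hST _ hτ) (hu2 (hpos hτ)) (hv2 (hpos hτ)) cφ cφ' hφA hφ'A hψc hψ'c hψ1 hψ'D hψev
  have hI2lim : ∀ {τ : ℝ}, τ ∈ Icc s t → Tendsto (fun R => I2 R τ) atTop (𝓝 (J2 τ)) := fun hτ =>
    circLaw_limit_I2 hk (hST _ hτ) (hu2 (hpos hτ)) (hv2 (hpos hτ)) (hdiv (hpos hτ)) cφ cφ' hφA hφ'A hψc hψ'c hψ1
      hψ'D hψev
  -- (5) uniform bounds on `[s, t]` for `R ≥ 1`
  have iK : IntegrableOn (fun q : ℝ × ℝ => Real.exp (-k * |q.2|)) (Ioc 0 L ×ˢ univ) := kato_integrableOn_weight hk L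
  have iW : IntegrableOn (fun q : ℝ × ℝ => (C + |q.2|) * Real.exp (-k * |q.2|)) (Ioc 0 L ×ˢ univ) :=
    kato_integrableOn_weight' hk hC L
  have hI1b : ∀ {R τ : ℝ}, 1 ≤ R → τ ∈ Icc s t → |I1 R τ| ≤ A * C * (1 + C) * Ik + A * C * (2 * Cσ) * IW :=
    fun {R τ} hR hτ => by
    rw [← Real.norm_eq_abs, hIk, hIW, ← integral_const_mul, ← integral_const_mul,
      ← integral_add (iK.const_mul _) (iW.const_mul _)]
    exact norm_integral_le_of_norm_le ((iK.const_mul _).add (iW.const_mul _))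
      (Eventually.of_forall fun q => by
        rw [Real.norm_eq_abs]; exact circLaw_I1_bound hk (hST τ hτ) hφA hφ'A hψ1 (hψ'D R hR) q)
  have hI2b : ∀ {R τ : ℝ}, 1 ≤ R → τ ∈ Icc s t → |I2 R τ| ≤ A * C * (1 + 2 * Cσ) * Ik := fun {R τ} hR hτ => by
    rw [← Real.norm_eq_abs, hIk, ← integral_const_mul]
    exact norm_integral_le_of_norm_le (iK.const_mul _)
      (Eventually.of_forall fun q => by
        rw [Real.norm_eq_abs]
        exact circLaw_I2_bound (hST τ hτ) (hu2 (hpos hτ)) (hv2 (hpos hτ)) (hdiv (hpos hτ)) hφA hφ'A hψ1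
          (hψ'D R hR) q)
  -- (6) dominated convergence in time
  set K : ℝ := A * C * (1 + C) * Ik + A * C * (2 * Cσ) * IW + ν * (A * C * (1 + 2 * Cσ) * Ik) with hK
  have hInt : Tendsto (fun R => ∫ τ in s..t, G R τ) atTop (𝓝 (∫ τ in s..t, (J1 τ - ν * J2 τ))) := by
    refine intervalIntegral.tendsto_integral_filter_of_dominated_convergence (fun _ => K) ?_ ?_
      intervalIntegrable_const ?_
    · filter_upwards [eventually_gt_atTop 0] with R hR
      exact ((hGc R hR).mono hIsub).aestronglyMeasurable measurableSet_uIoc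
    · filter_upwards [eventually_ge_atTop 1] with R hR
      refine Eventually.of_forall fun τ hτ => ?_
      rw [uIoc_of_le hst] at hτ
      have hτI : τ ∈ Icc s t := ⟨hτ.1.le, hτ.2⟩
      have h1 := hI1b hR hτI
      have h2 := hI2b hR hτI
      rw [Real.norm_eq_abs, hGI R (one_pos.trans_le hR) τ (hpos hτI)]
      calc |I1 R τ - ν * I2 R τ| ≤ |I1 R τ| + |ν * I2 R τ| := abs_sub _ _
        _ = |I1 R τ| + ν * |I2 R τ| := by rw [abs_mul, abs_of_nonneg hν]
        _ ≤ K := add_le_add h1 (mul_le_mul_of_nonneg_left h2 hν)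
    · refine Eventually.of_forall fun τ hτ => ?_
      rw [uIoc_of_le hst] at hτ
      have hτI : τ ∈ Icc s t := ⟨hτ.1.le, hτ.2⟩
      refine ((hI1lim hτI).sub ((hI2lim hτI).const_mul ν)).congr' ?_
      filter_upwards [eventually_gt_atTop 0] with R hR
      exact (hGI R hR τ (hpos hτI)).symm
  -- (7) conclusion
  have hLHS : Tendsto (fun R => N R t - N R s) atTop (𝓝 (M t - M s)) :=
    (hNlim ⟨hst, le_rfl⟩).sub (hNlim ⟨le_rfl, hst⟩)
  have hRHS : Tendsto (fun R => N R t - N R s) atTop (𝓝 (∫ τ in s..t, (J1 τ - ν * J2 τ))) := by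
    refine hInt.congr' ?_
    filter_upwards [eventually_gt_atTop 0] with R hR
    exact (hFTC R hR).symm
  exact tendsto_nhds_unique hLHS hRHS

end Solution

/-! ## The registered sub-goal -/

/-- **THE CIRCULATION-DENSITY LAW, WEAK FORM (registered sub-goal `circulationDensity_weak_law` of line
`FirstLemmasR2K4`).** Along every classical solution of the stretched layer class on `(0, ∞)` (`ν, L > 0`) with shear
tails on compact time intervals, for every `L`-periodic test function `φ ∈ C²` and `0 < s ≤ t`:
`∫_{x ∈ (0,L]} ∫_y φω(t) − ∫_{x ∈ (0,L]} ∫_y φω(s) = ∫_s^t (ν ∫_{x ∈ (0,L]} ∫_y φ″ω(τ) − ∫_{x ∈ (0,L]} ∫_y φ″u(τ)v(τ)) dτ`,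
i.e. `∂ₜγ = ∂ₓₓ(Π + νγ)` for `γ = −∫_y ω`, `Π = ∫_y uv` (`circLaw_strip_identity`, then `∫∫ ωuφ′ = −∫∫ φ″uv`,
`∫∫ ∂ₓω φ′ = −∫∫ φ″ω` and Fubini at each instant of `[s, t]`). [folklore] -/
theorem circulationDensity_weak_law : ∀ (ν L : ℝ), 0 < ν → 0 < L → ∀ (u v p : ℝ → ℝ → ℝ → ℝ),
    IsStretchedLayerNSSolutionOn (Ioi 0) ν 1 1 L u v p → (∀ a b : ℝ, 0 < a → a < b → ExpTails (Icc a b) u v) →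
    ∀ φ : ℝ → ℝ, ContDiff ℝ 2 φ → (∀ x, φ (x + L) = φ x) → ∀ s t : ℝ, 0 < s → s ≤ t →
      (∫ x in Ioc 0 L, ∫ y, φ x * vorticity (u t) (v t) x y) - (∫ x in Ioc 0 L, ∫ y, φ x * vorticity (u s) (v s) x y) =
        ∫ τ in s..t, (ν * (∫ x in Ioc 0 L, ∫ y, deriv (deriv φ) x * vorticity (u τ) (v τ) x y) -
          ∫ x in Ioc 0 L, ∫ y, deriv (deriv φ) x * (u τ x y * v τ x y)) := by
  intro ν L hν hL u v p hsol htails φ hφ hφper s t hs hst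
  have h := circLaw_strip_identity hν.le hL hsol htails hφ hφper hs hst
  obtain ⟨C, k, hk, hCk⟩ := htails (s / 2) (t + 1) (by positivity) (by linarith)
  have hST : ∀ τ ∈ Icc s t, SliceTails C k (u τ) (v τ) := fun τ hτ =>
    (hCk τ ⟨by linarith [hτ.1], by linarith [hτ.2]⟩).1
  have hC : 0 ≤ C := (hST s ⟨le_rfl, hst⟩).nonneg
  obtain ⟨-, hφ'd, cφ', cφ'', hφ'per, -, A, -, hφA, hφ'A, hφ''A⟩ := circLaw_testFunction hL hφ hφper
  have cφ : Continuous φ := hφ.continuous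
  have hpos : ∀ {τ : ℝ}, τ ∈ Icc s t → (τ ∈ Ioi (0:ℝ)) := fun hτ => hs.trans_le hτ.1
  have cω : ∀ {τ : ℝ}, τ ∈ Icc s t → Continuous fun q : ℝ × ℝ => vorticity (u τ) (v τ) q.1 q.2 := fun hτ =>
    (contDiff_one_vorticity (hsol.contDiff_u (hpos hτ)) (hsol.contDiff_v (hpos hτ))).continuous
  -- the iterated integrals are strip integrals
  have eN : ∀ τ ∈ Icc s t, (∫ x in Ioc 0 L, ∫ y, φ x * vorticity (u τ) (v τ) x y) =
      ∫ q in Ioc 0 L ×ˢ univ, φ q.1 * vorticity (u τ) (v τ) q.1 q.2 := fun τ hτ =>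
    integral_iterated_eq_strip (F := fun q : ℝ × ℝ => φ q.1 * vorticity (u τ) (v τ) q.1 q.2)
      (integrableOn_strip_bdd_mul_decay (K := fun x _ => φ x) hk (cφ.comp continuous_fst) (cω hτ)
        (fun x _ => hφA x) hC (tails_abs_vorticity_le (hST τ hτ)))
  have eA : ∀ τ ∈ Icc s t, (∫ x in Ioc 0 L, ∫ y, deriv (deriv φ) x * vorticity (u τ) (v τ) x y) =
      ∫ q in Ioc 0 L ×ˢ univ, deriv (deriv φ) q.1 * vorticity (u τ) (v τ) q.1 q.2 := fun τ hτ =>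
    integral_iterated_eq_strip (F := fun q : ℝ × ℝ => deriv (deriv φ) q.1 * vorticity (u τ) (v τ) q.1 q.2)
      (integrableOn_strip_bdd_mul_decay (K := fun x _ => deriv (deriv φ) x) hk (cφ''.comp continuous_fst) (cω hτ)
        (fun x _ => hφ''A x) hC (tails_abs_vorticity_le (hST τ hτ)))
  have eB : ∀ τ ∈ Icc s t, (∫ x in Ioc 0 L, ∫ y, deriv (deriv φ) x * (u τ x y * v τ x y)) =
      ∫ q in Ioc 0 L ×ˢ univ, deriv (deriv φ) q.1 * (u τ q.1 q.2 * v τ q.1 q.2) := fun τ hτ =>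
    integral_iterated_eq_strip (F := fun q : ℝ × ℝ => deriv (deriv φ) q.1 * (u τ q.1 q.2 * v τ q.1 q.2))
      (integrableOn_strip_bdd_mul_decay (K := fun x _ => deriv (deriv φ) x) hk (cφ''.comp continuous_fst)
        ((hsol.contDiff_u (hpos hτ)).continuous.mul (hsol.contDiff_v (hpos hτ)).continuous) (fun x _ => hφ''A x)
        (by positivity) fun x y => circLaw_abs_mul_le ((hST τ hτ).abs_u_le hk x y) ((hST τ hτ).abs_v_le x y))
  -- the slice identities at each instant
  have eJ1 : ∀ τ ∈ Icc s t, ∫ q in Ioc 0 L ×ˢ univ, vorticity (u τ) (v τ) q.1 q.2 * u τ q.1 q.2 * deriv φ q.1 =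
      -∫ q in Ioc 0 L ×ˢ univ, deriv (deriv φ) q.1 * (u τ q.1 q.2 * v τ q.1 q.2) := fun τ hτ =>
    circLaw_integral_vorticity_mul_u hL hk (hST τ hτ) (hsol.contDiff_u (hpos hτ)) (hsol.contDiff_v (hpos hτ))
      (hsol.divFree τ (hpos hτ)) (hsol.periodic_u τ (hpos hτ)) (hsol.periodic_v τ (hpos hτ))
      (hsol.tendsto_u_atTop τ (hpos hτ)) (hsol.tendsto_u_atBot τ (hpos hτ)) hφ'd cφ'' hφ'per hφ'A hφ''A
  have eJ2 : ∀ τ ∈ Icc s t, ∫ q in Ioc 0 L ×ˢ univ, dX (vorticity (u τ) (v τ)) q.1 q.2 * deriv φ q.1 =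
      -∫ q in Ioc 0 L ×ˢ univ, deriv (deriv φ) q.1 * vorticity (u τ) (v τ) q.1 q.2 := fun τ hτ =>
    circLaw_integral_dX_vorticity_mul hL hk (hST τ hτ) (hsol.contDiff_u (hpos hτ)) (hsol.contDiff_v (hpos hτ))
      (hsol.divFree τ (hpos hτ)) (hsol.periodic_u τ (hpos hτ)) (hsol.periodic_v τ (hpos hτ)) hφ'd cφ'' hφ'per
      hφ'A hφ''A
  rw [eN t ⟨hst, le_rfl⟩, eN s ⟨le_rfl, hst⟩, h]
  refine intervalIntegral.integral_congr fun τ hτ => ?_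
  rw [uIcc_of_le hst] at hτ
  rw [eJ1 τ hτ, eJ2 τ hτ, eA τ hτ, eB τ hτ]
  ring

end Summit.AnomalousDissipation.AnomalousDissipation.Theorems.StrainedLayerLaw.LogEnstrophyClock

end
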